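import Mathlib

/-!
# Route GeneratorObstructions — crux K2 `PowGenDegreeQP` (stmt-ValiantsHypothesis-11655), line
# `trace-side-regimes`: class-preserving permutations are products of fibre permutations (with signs)

Generic tool for the last remaining theorem of the tableau certificate (`gadgetTab_count`, factorisation
half; see the skeleton attached to the item and `…GadgetTableauTypes` for the type-preservation half):
after type preservation every column permutation `π_n` preserves the partition of the column's rows
into block classes, and the signed count must be split along that partition.  For a class map
`f : α → K` on a finite type:

* `fiberPerm f ρ` — the permutation of `α` assembled from permutations `ρ k` of the fibres
  `{a // f a = k}` (`Equiv.sigmaFiberEquiv` + `Equiv.Perm.sigmaCongrRight`); `fiberPerm_apply`,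
  `apply_fiberPerm` (it preserves `f`), `sign_fiberPerm : sign = ∏_k sign (ρ k)`,
  `fiberPerm_injective`;
* `restrictFibers` — the inverse on class-preserving permutations, `fiberPerm_restrictFibers`;
* `sum_ite_classPreserving` — **`Σ_{π ∈ Perm α, π preserves f} F π = Σ_{ρ : Π k, Perm (fibre k)} F (fiberPerm f ρ)`**,
  and its signed form `sum_sign_ite_classPreserving`.

Honest framing: elementary finite group combinatorics; no stub, crux or summit is settled here;
`VP ≠ VNP` untouched. [folklore]
-/

namespace Summit.ValiantsHypothesis.ValiantsHypothesis.Theorems.GeneratorObstructions.PowGenDegreeQP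

-- `Summit.ValiantsHypothesis.ValiantsHypothesis.…` is the tree's mandated single-conjunct layout.
set_option linter.dupNamespace false

section PermFibers

variable {α K : Type*} (f : α → K)

/-- The permutation of `α` assembled from permutations of the fibres of `f`. [folklore] -/
def fiberPerm (ρ : (k : K) → Equiv.Perm {a : α // f a = k}) : Equiv.Perm α :=
  (Equiv.sigmaFiberEquiv f).permCongr (Equiv.Perm.sigmaCongrRight ρ)

/-- `fiberPerm f ρ a = ρ (f a) a`. [folklore] -/
@[simp] theorem fiberPerm_apply (ρ : (k : K) → Equiv.Perm {a : α // f a = k}) (a : α) :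
    fiberPerm f ρ a = (ρ (f a) ⟨a, rfl⟩).val := by
  rfl

/-- `fiberPerm f ρ` preserves the classes of `f`. [folklore] -/
theorem apply_fiberPerm (ρ : (k : K) → Equiv.Perm {a : α // f a = k}) (a : α) :
    f (fiberPerm f ρ a) = f a := by
  rw [fiberPerm_apply]
  exact (ρ (f a) ⟨a, rfl⟩).prop

/-- A list product of fibre permutations (extended by the identity) acts on `a` through the factor of
its own class, if that class is listed. [folklore] -/
theorem list_prod_ofSubtype_apply [DecidableEq K] (ρ : (k : K) → Equiv.Perm {a : α // f a = k}) :
    ∀ (l : List K), l.Nodup → ∀ a : α,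
      (l.map fun k => Equiv.Perm.ofSubtype (ρ k)).prod a =
        if f a ∈ l then (ρ (f a) ⟨a, rfl⟩).val else a
  | [], _, a => by simp
  | k :: l, hl, a => by
    have hnd : l.Nodup := (List.nodup_cons.mp hl).2
    have hk : k ∉ l := (List.nodup_cons.mp hl).1
    rw [List.map_cons, List.prod_cons, Equiv.Perm.mul_apply, list_prod_ofSubtype_apply ρ l hnd a]
    by_cases ha : f a ∈ l
    · rw [if_pos ha, if_pos (List.mem_cons_of_mem k ha)]
      -- the factor `k ≠ f a` fixes an element of class `f a`
      have hne : f (ρ (f a) ⟨a, rfl⟩).val ≠ k := by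
        rw [(ρ (f a) ⟨a, rfl⟩).prop]
        exact fun h => hk (h ▸ ha)
      exact Equiv.Perm.ofSubtype_apply_of_not_mem (ρ k) hne
    · rw [if_neg ha]
      by_cases hka : f a = k
      · subst hka
        rw [if_pos List.mem_cons_self]
        exact Equiv.Perm.ofSubtype_apply_of_mem (ρ (f a)) rfl
      · rw [if_neg (by simp [hka, ha])]
        exact Equiv.Perm.ofSubtype_apply_of_not_mem (ρ k) hka

/-- The assembled permutation is the (list) product of the fibre permutations extended by the
identity. [folklore] -/
theorem fiberPerm_eq_list_prod [DecidableEq K] [Fintype K] (ρ : (k : K) → Equiv.Perm {a : α // f a = k}) :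
    fiberPerm f ρ = ((Finset.univ : Finset K).toList.map fun k => Equiv.Perm.ofSubtype (ρ k)).prod := by
  ext a
  rw [fiberPerm_apply, list_prod_ofSubtype_apply f ρ _ (Finset.nodup_toList _) a,
    if_pos (Finset.mem_toList.mpr (Finset.mem_univ _))]

/-- **The sign of an assembled permutation is the product of the signs on the fibres.** [folklore] -/
theorem sign_fiberPerm [DecidableEq α] [Fintype α] [DecidableEq K] [Fintype K] (ρ : (k : K) → Equiv.Perm {a : α // f a = k}) :
    Equiv.Perm.sign (fiberPerm f ρ) = ∏ k, Equiv.Perm.sign (ρ k) := by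
  rw [fiberPerm_eq_list_prod, map_list_prod, List.map_map, ← Finset.prod_map_toList]
  congr 1
  refine List.map_congr_left fun k _ => ?_
  simp [Equiv.Perm.sign_ofSubtype]

/-- `fiberPerm f` is injective. [folklore] -/
theorem fiberPerm_injective : Function.Injective (fiberPerm f) := by
  intro ρ ρ' h
  have h' : Equiv.Perm.sigmaCongrRight ρ = Equiv.Perm.sigmaCongrRight ρ' :=
    (Equiv.sigmaFiberEquiv f).permCongr.injective h
  exact Equiv.Perm.sigmaCongrRightHom_injective h'

/-- The restriction of a class-preserving permutation to the fibres. [folklore] -/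
def restrictFibers (π : Equiv.Perm α) (hπ : ∀ a, f (π a) = f a) :
    (k : K) → Equiv.Perm {a : α // f a = k} :=
  fun k => π.subtypePerm (fun a => by rw [hπ a])

/-- Assembling the restrictions gives back the permutation. [folklore] -/
theorem fiberPerm_restrictFibers (π : Equiv.Perm α) (hπ : ∀ a, f (π a) = f a) :
    fiberPerm f (restrictFibers f π hπ) = π := by
  ext a
  rw [fiberPerm_apply]
  rfl

/-- The class-preserving permutations are exactly the assembled ones. [folklore] -/
theorem filter_classPreserving_eq_image [DecidableEq α] [Fintype α] [DecidableEq K] [Fintype K] :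
    (Finset.univ.filter fun π : Equiv.Perm α => ∀ a, f (π a) = f a) =
      Finset.univ.image (fiberPerm f) := by
  ext π
  simp only [Finset.mem_filter, Finset.mem_univ, true_and, Finset.mem_image]
  constructor
  · intro hπ
    exact ⟨restrictFibers f π hπ, fiberPerm_restrictFibers f π hπ⟩
  · rintro ⟨ρ, rfl⟩
    exact apply_fiberPerm f ρ

/-- **Summing over class-preserving permutations = summing over tuples of fibre permutations.**
[folklore] -/
theorem sum_ite_classPreserving [DecidableEq α] [Fintype α] [DecidableEq K] [Fintype K] {M : Type*} [AddCommMonoid M]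
    (F : Equiv.Perm α → M) :
    (∑ π : Equiv.Perm α, if (∀ a, f (π a) = f a) then F π else 0) =
      ∑ ρ : (k : K) → Equiv.Perm {a : α // f a = k}, F (fiberPerm f ρ) := by
  rw [← Finset.sum_filter, filter_classPreserving_eq_image,
    Finset.sum_image (fun ρ _ ρ' _ h => fiberPerm_injective f h)]

/-- **Signed form**: `Σ_{π preserves f} sign π · G π = Σ_ρ (∏_k sign ρ_k) · G (fiberPerm f ρ)`.
[folklore] -/
theorem sum_sign_ite_classPreserving [DecidableEq α] [Fintype α] [DecidableEq K] [Fintype K] {R : Type*} [CommRing R]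
    (G : Equiv.Perm α → R) :
    (∑ π : Equiv.Perm α, if (∀ a, f (π a) = f a) then ((Equiv.Perm.sign π : ℤ) : R) * G π else 0) =
      ∑ ρ : (k : K) → Equiv.Perm {a : α // f a = k},
        (∏ k, ((Equiv.Perm.sign (ρ k) : ℤ) : R)) * G (fiberPerm f ρ) := by
  rw [sum_ite_classPreserving f (fun π => ((Equiv.Perm.sign π : ℤ) : R) * G π)]
  refine Finset.sum_congr rfl fun ρ _ => ?_
  rw [sign_fiberPerm, Units.coe_prod, Int.cast_prod]

end PermFibers

end Summit.ValiantsHypothesis.ValiantsHypothesis.Theorems.GeneratorObstructions.PowGenDegreeQP
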